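import Literature.NumberTheory.Rogawski1990.LocalStableClassesNonsplitRankTwoIrreducible   -- ★ ONE class for irreducible `χ_g`: `isConj_of_isStablyConj_of_irreducible_rankTwo`
import Literature.NumberTheory.Rogawski1990.LocalStableClassesRankTwoOccurs                -- ★ `isStablyConj_iff_charpoly_eq_of_separable`
import Literature.NumberTheory.Rogawski1990.QuasiSplitRankTwoPrescribedCharpoly            -- ★ quadratic Hilbert 90 `exists_ne_zero_eq_neg_mul_map`
import Literature.NumberTheory.Rogawski1990.UnitStableOrbitalIntegralIrredOneClass          -- ★ `adelicForm_antidiagTwo_local_hermitian`, `isUnit_det_adelicForm_antidiagTwo_local`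
import Literature.NumberTheory.Automorphic.UnitaryGroupBorelInduction                       -- ★ `cmLocalForm`, `conjLocal_conjLocal_cm`
import Literature.NumberTheory.Automorphic.UnitaryGroupArithmeticLevels                     -- ★ `unitaryGroup_eq_unitaryGroupOfForm`
import Literature.NumberTheory.Automorphic.QuadraticHeckeCharacterCM                        -- ★ `cmQuadraticGenerator_spec` (a purely imaginary `α ≠ 0` of the CM field)
import HarnessLib

/-!
# R90 · S6 «Ch. 14.1–14.5 stable TF» — «CLASSIFY» FILE C2: the TYPE-(2) CELL of `U(1,1)` — every elliptic element with IRREDUCIBLE characteristic polynomial is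
# conjugate IN `U(Φ₂)` to a CORNER LITERAL `(A, Cρ; C, A)` (`Theorems/R90S6GRegularCellsU2TypeTwo.lean`; T2-ASM census 15fbf54e §2 «CLASSIFY», cell ELL-2)

Cell `hodgecm-mathlib`, crux H413 (`stmt-HodgeConjecture-24833`), route `HCCMUnconditional`; programme R90-TF, section S6 (base `R90-C14`); seat K2E3-p11 (g11)
(«CLASSIFY» census 03:30:00Z; dealer R90-C14-plan (g3) :40 report 03:37:14Z «K2E3-p11 keeps C0 + C2 + the CM dress»).  Lane `--kind proof --supports
stmt-HodgeConjecture-24833 --as helper`; THEOREMS ONLY (no definition, no instance, no notation, no named fact, no `sorry`).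

## The mathematics ([Rogawski1990, §3.6 p. 31, Lemma 3.6.1; §3.5 Prop. 3.5.2 (a)(c)]; [Flicker1998UnitaryFL, §3 p. 80, Thm. 18 p. 97])
`K` a field with a non-trivial involution `σ`, `2 ≠ 0`; `Φ₂ = antidiag(1,1)`; `g ∈ U(σ, Φ₂)` with `t = tr g`, `n = det g`.
* §1 **σ-RECIPROCITY** `det_mul_map_det_eq_one_of_mem`, `trace_eq_map_trace_mul_det_of_mem`: `n σn = 1`, `t = σt · n` — read off the four entries of `ᵗσ(g) Φ₂ g = Φ₂`.
* §2 **THE CORNER LITERAL EXISTS** `exists_corner_of_reciprocal`: for such `(t, n)` with `t² ≠ 4n` there are `A C ρ` with `2A = t`, `C ≠ 0`, `σρ = ρ ≠ 0`, `A² − C²ρ = n` and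
  the two UNITARITY RELATIONS `AσC + CσA = 0`, `σA·A + ρ·σC·C = 1` — `A := t∕2`, `C :=` the quadratic Hilbert-90 solution of `C = −n·σC` (★ `exists_ne_zero_eq_neg_mul_map`),
  `ρ := (A² − n)∕C²` (σ-fixed by the two symmetries); `corner_rescale`: `(A, C·f, ρ∕f²)` is again such a triple for every σ-fixed `f ≠ 0` (so `|ρ|` can be moved
  through the σ-fixed square classes — the CM dress puts `|ρ| = |ϖ|`, the discriminant class being `ϖ`, ★ `exists_valued_disc_eq_exp_neg_odd_of_not_exists_isRoot`).
* §3 **THE CORNER IS UNITARY WITH THE RIGHT CHARACTERISTIC POLYNOMIAL** `corner_mem_unitaryGroupOfForm`, `charpoly_corner`: `(A, Cρ; C, A) ∈ U(σ, Φ₂)` under the two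
  relations, `χ = X² − 2A·X + (A² − C²ρ)`.
* §4 **LOCAL CURRENCY (`E ⊗_F F_v`, `v` non-split): ONE CLASS** `exists_mem_conj_eq_corner_of_irreducible`: for `g ∈ U(Φ₂)(F_v)` with `χ_g` irreducible and separable
  there is a corner literal `δ = (A, Cρ; C, A) ∈ U(Φ₂)(F_v)` and `h ∈ U(Φ₂)(F_v)` with `h g h⁻¹ = δ` (§2–§3 give `χ_δ = χ_g`, ★ `isStablyConj_iff_charpoly_eq_of_separable`,
  ★ `isConj_of_isStablyConj_of_irreducible_rankTwo` = Rog90 Lemma 3.6.1's «𝓔_H(T) trivial» for the ramified torus of `U(1,1)`); CM spelling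
  `exists_conj_fst_eq_corner_of_irreducible` on `H_v = U(Φ₂)(L⁺_v) × U(Φ₁)(L⁺_v)` — the (E2) letter shape `hδ : δ.val = !![A, C * ρ; C, A]`.
NOT here: `|ρ| = |ϖ|` ∕ `|C| = |ϖ^N|` (valuation dress, file C3 with the trichotomy head on `IsLocalGRegular`).
HONEST LABEL: helper algebra, count-neutral; HC_CM is proved only modulo the 7 printed citations (2 remaining named inputs: hLiu418 = stmt-HodgeConjecture-24832,
h413 = stmt-HodgeConjecture-24833) until rung 0 closes.

## References
* [Rogawski1990] J. D. Rogawski, *Automorphic Representations of Unitary Groups in Three Variables* (1990), §3.6 p. 31, Lemma 3.6.1 p. 28; §3.5 Prop. 3.5.2 (a)(c) p. 29.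
* [Flicker1998UnitaryFL] Y. Z. Flicker, *Elementary proof of the fundamental lemma for a unitary group*, Canad. J. Math. 50 (1998), §3 p. 80 (`t_θ`), Thm. 18 p. 97.
* [CasselsFrohlichANT1967] J. W. S. Cassels, A. Fröhlich (eds.), *Algebraic Number Theory* (1967), Ch. V §2.7 Prop. 5 (Hilbert 90, cyclic case).
-/

set_option autoImplicit false
set_option linter.dupNamespace false  -- the mandated namespace repeats the single-problem summit's segment (`HodgeConjecture.HodgeConjecture`)

noncomputable section

open Matrix NumberField IsDedekindDomain Polynomial
open Literature.NumberTheory.Automorphic Literature.NumberTheory.Automorphic.UnitaryGroup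
open Literature.NumberTheory.Rogawski1990
open Literature.AlgebraicGeometry.ShimuraVarieties (unitaryGroup mem_unitaryGroup_iff unitaryGroup_eq_unitaryGroupOfForm)
open scoped Matrix MatrixGroups

namespace Summit.HodgeConjecture.HodgeConjecture.R90.S6

section Generic

variable {K : Type} [Field K] (σ : K →+* K)

/-! ## §1 σ-reciprocity of `(tr g, det g)` for `g ∈ U(σ, Φ₂)` -/

/-- The four entry relations of `ᵗσ(g) Φ₂ g = Φ₂` for `g = (p q; r s)`: `σr·p + σp·r = 0`, `σr·q + σp·s = 1`, `σs·p + σq·r = 1`, `σs·q + σq·s = 0`.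
[cite: Rogawski1990, §3.1 p. 19] -/
theorem entry_relations_of_mem {g : GL (Fin 2) K} (hg : g ∈ unitaryGroupOfForm σ (Matrix.of fun i j : Fin 2 => if i.val + j.val + 1 = 2 then (1 : K) else 0)) :
    σ (g.val 1 0) * g.val 0 0 + σ (g.val 0 0) * g.val 1 0 = 0 ∧ σ (g.val 1 0) * g.val 0 1 + σ (g.val 0 0) * g.val 1 1 = 1 ∧
      σ (g.val 1 1) * g.val 0 0 + σ (g.val 0 1) * g.val 1 0 = 1 ∧ σ (g.val 1 1) * g.val 0 1 + σ (g.val 0 1) * g.val 1 1 = 0 := by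
  have h := mem_unitaryGroupOfForm_iff.1 hg
  have hij := fun i j => congrFun (congrFun h i) j
  have h00 := hij 0 0; have h01 := hij 0 1; have h10 := hij 1 0; have h11 := hij 1 1
  simp only [Matrix.mul_apply, Fin.sum_univ_two, Matrix.transpose_apply, Matrix.map_apply, Matrix.of_apply] at h00 h01 h10 h11
  norm_num at h00 h01 h10 h11
  refine ⟨?_, ?_, ?_, ?_⟩
  · linear_combination h00
  · linear_combination h01
  · linear_combination h10
  · linear_combination h11

/-- **`det g · σ(det g) = 1`** for `g ∈ U(σ, Φ₂)`: `(e₂)(e₃) − (e₁)(e₄)` of the entry relations. [cite: Rogawski1990, §3.1 p. 19] -/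
theorem det_mul_map_det_eq_one_of_mem {g : GL (Fin 2) K} (hg : g ∈ unitaryGroupOfForm σ (Matrix.of fun i j : Fin 2 => if i.val + j.val + 1 = 2 then (1 : K) else 0)) :
    g.val.det * σ g.val.det = 1 := by
  obtain ⟨e1, e2, e3, e4⟩ := entry_relations_of_mem σ hg
  rw [Matrix.det_fin_two, map_sub, map_mul, map_mul]
  linear_combination (σ (g.val 1 0) * g.val 0 1 + σ (g.val 0 0) * g.val 1 1) * e3 + e2 -
    (σ (g.val 1 0) * g.val 0 0 + σ (g.val 0 0) * g.val 1 0) * e4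

/-- **`tr g = σ(tr g) · det g`** for `g ∈ U(σ, Φ₂)` — the σ-reciprocity of `χ_g = X² − tX + n` (its roots are stable under `r ↦ σ(r)⁻¹`); `p·(e₂) + s·(e₃) − q·(e₁) − r·(e₄)`.
[cite: Rogawski1990, §3.5–§3.6 pp. 29–33] -/
theorem trace_eq_map_trace_mul_det_of_mem {g : GL (Fin 2) K} (hg : g ∈ unitaryGroupOfForm σ (Matrix.of fun i j : Fin 2 => if i.val + j.val + 1 = 2 then (1 : K) else 0)) :
    g.val.trace = σ g.val.trace * g.val.det := by
  obtain ⟨e1, e2, e3, e4⟩ := entry_relations_of_mem σ hg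
  rw [Matrix.trace_fin_two, Matrix.det_fin_two, map_add]
  linear_combination (-(g.val 0 0)) * e2 - g.val 1 1 * e3 + g.val 0 1 * e1 + g.val 1 0 * e4

/-! ## §2 The corner literal `(A, Cρ; C, A)` with prescribed `(tr, det)` exists (quadratic Hilbert 90) -/

/-- **THE CORNER DATA OF A σ-RECIPROCAL PAIR.**  `σ` a non-trivial involution of `K`, `2 ≠ 0`; `t n : K` with `n σn = 1`, `t = σt·n` and `t² ≠ 4n` (separable).  Then there
are `A C ρ : K` with `2A = t`, `C ≠ 0`, `σρ = ρ`, `ρ ≠ 0`, `A² − C²ρ = n`, and the UNITARITY RELATIONS of the corner `(A, Cρ; C, A)`: `AσC + CσA = 0`, `σA·A + ρ(σC·C) = 1`.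
CONSTRUCTION: `A := t∕2` (`σA = A∕n`), `C ≠ 0` with `C = −n·σC` (★ quadratic Hilbert 90 `exists_ne_zero_eq_neg_mul_map`), `ρ := (A² − n)∕C²`.
[cite: Rogawski1990, §3.6 p. 31, Lemma 3.6.1 p. 28] [cite: Flicker1998UnitaryFL, §3 p. 80] [cite: CasselsFrohlichANT1967, Ch. V §2.7 Prop. 5] -/
theorem exists_corner_of_reciprocal (hσσ : ∀ x, σ (σ x) = x) (hσ : ∃ z, σ z ≠ z) (h2 : (2 : K) ≠ 0) {t n : K} (hn : n * σ n = 1) (ht : t = σ t * n)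
    (hΔ : t ^ 2 ≠ 4 * n) :
    ∃ A C ρ : K, 2 * A = t ∧ C ≠ 0 ∧ σ ρ = ρ ∧ ρ ≠ 0 ∧ A ^ 2 - C ^ 2 * ρ = n ∧ A * σ C + C * σ A = 0 ∧ σ A * A + ρ * (σ C * C) = 1 := by
  have hn0 : n ≠ 0 := left_ne_zero_of_mul_eq_one hn
  have hσn : σ n = n⁻¹ := eq_inv_of_mul_eq_one_right hn
  obtain ⟨C, hC0, hC⟩ := exists_ne_zero_eq_neg_mul_map σ hσσ hσ hn
  -- `σC = −C∕n`, `σA = A∕n`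
  have hσC : σ C = -(C * n⁻¹) := by
    have h := congrArg σ hC
    rw [map_mul, map_neg, hσσ, hσn] at h
    rw [h]; field_simp
  set A : K := t / 2 with hA
  have h2A : 2 * A = t := by rw [hA]; field_simp
  have hσA : σ A = A * n⁻¹ := by
    have hσ2 : σ 2 = 2 := by rw [← one_add_one_eq_two, map_add, map_one]
    have hσt : σ t = t * n⁻¹ := by
      rw [eq_mul_inv_iff_mul_eq₀ hn0]; exact ht.symm
    rw [hA, map_div₀, hσ2, hσt]; ring
  have hC2 : C ^ 2 ≠ 0 := pow_ne_zero 2 hC0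
  have hAn : A ^ 2 - n ≠ 0 := by
    intro h0
    apply hΔ
    have : t = 2 * A := h2A.symm
    rw [this]; linear_combination 4 * h0
  refine ⟨A, C, (A ^ 2 - n) / C ^ 2, h2A, hC0, ?_, div_ne_zero hAn hC2, ?_, ?_, ?_⟩
  · rw [map_div₀, map_sub, map_pow, map_pow, hσA, hσC, hσn]
    field_simp
    try ring
  · field_simp
    try ring
  · rw [hσC, hσA]; ring
  · rw [hσA, hσC]
    field_simp
    try ring

/-- **RESCALING THE CORNER**: if `(A, C, ρ)` satisfy the corner relations then so do `(A, C·f, ρ∕f²)` for every σ-fixed `f ≠ 0` (the torus parameter `C` is defined up to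
the fixed field; the CM dress uses `f = ϖ^k` to put `|ρ| = |ϖ|`). [cite: Rogawski1990, §3.6 p. 31] [cite: Flicker1998UnitaryFL, §3 p. 80] -/
theorem corner_rescale {A C ρ f : K} (hσf : σ f = f) (hf : f ≠ 0) {n : K} (hdet : A ^ 2 - C ^ 2 * ρ = n) (h1 : A * σ C + C * σ A = 0)
    (h2 : σ A * A + ρ * (σ C * C) = 1) (hσρ : σ ρ = ρ) :
    A ^ 2 - (C * f) ^ 2 * (ρ / f ^ 2) = n ∧ A * σ (C * f) + C * f * σ A = 0 ∧ σ A * A + ρ / f ^ 2 * (σ (C * f) * (C * f)) = 1 ∧ σ (ρ / f ^ 2) = ρ / f ^ 2 := by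
  refine ⟨?_, ?_, ?_, ?_⟩
  · rw [← hdet]; field_simp
  · rw [map_mul, hσf]; linear_combination f * h1
  · rw [map_mul, hσf, ← h2]; field_simp
  · rw [map_div₀, map_pow, hσf, hσρ]

/-! ## §3 The corner is `Φ₂`-unitary and has characteristic polynomial `X² − 2A·X + (A² − C²ρ)` -/

/-- **`(A, Cρ; C, A) ∈ U(σ, Φ₂)`** under the two corner relations (`ρ` σ-fixed): the four entries of `ᵗσ(M) Φ₂ M` are `AσC + CσA`, `σA·A + ρ σC·C` and their
σ-partners. [cite: Rogawski1990, §3.6 p. 31] [cite: Flicker1998UnitaryFL, §3 p. 80] -/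
theorem corner_mem_unitaryGroupOfForm {A C ρ : K} (hσρ : σ ρ = ρ) (h1 : A * σ C + C * σ A = 0)
    (h2 : σ A * A + ρ * (σ C * C) = 1) (M : GL (Fin 2) K) (hM : M.val = !![A, C * ρ; C, A]) :
    M ∈ unitaryGroupOfForm σ (Matrix.of fun i j : Fin 2 => if i.val + j.val + 1 = 2 then (1 : K) else 0) := by
  rw [mem_unitaryGroupOfForm_iff]
  have hval : (M : Matrix (Fin 2) (Fin 2) K) = !![A, C * ρ; C, A] := hM
  rw [hval]
  ext i j
  fin_cases i <;> fin_cases j <;> simp [Matrix.mul_apply, Fin.sum_univ_two, hσρ]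
  · linear_combination h1
  · linear_combination h2
  · linear_combination h2
  · linear_combination ρ * h1

/-- The corner's determinant and characteristic polynomial: `det = A² − C²ρ`, `χ = X² − C(2A)·X + C(A² − C²ρ)` (Mathlib `Matrix.charpoly_fin_two`).
[cite: Rogawski1990, §3.6 p. 31] -/
theorem charpoly_corner (A C ρ : K) :
    (!![A, C * ρ; C, A] : Matrix (Fin 2) (Fin 2) K).det = A ^ 2 - C ^ 2 * ρ ∧
      (!![A, C * ρ; C, A] : Matrix (Fin 2) (Fin 2) K).charpoly = X ^ 2 - Polynomial.C (2 * A) * X + Polynomial.C (A ^ 2 - C ^ 2 * ρ) := by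
  have hdet : (!![A, C * ρ; C, A] : Matrix (Fin 2) (Fin 2) K).det = A ^ 2 - C ^ 2 * ρ := by
    rw [Matrix.det_fin_two_of]; ring
  refine ⟨hdet, ?_⟩
  rw [Matrix.charpoly_fin_two, hdet, Matrix.trace_fin_two_of, two_mul]

/-- **A `Φ₂`-UNITARY CORNER WITH PRESCRIBED CHARACTERISTIC POLYNOMIAL.**  For every `g ∈ U(σ, Φ₂)` whose characteristic polynomial is separable in the weak sense
`tr² ≠ 4 det` there is a corner `δ = (A, Cρ; C, A) ∈ U(σ, Φ₂)` (`C ≠ 0`, `σρ = ρ ≠ 0`) with `χ_δ = χ_g` (§1 + §2 + §3). [cite: Rogawski1990, §3.6 p. 31, Lemma 3.6.1 p. 28]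
[cite: Flicker1998UnitaryFL, §3 p. 80] -/
theorem exists_corner_mem_charpoly_eq (hσσ : ∀ x, σ (σ x) = x) (hσ : ∃ z, σ z ≠ z) (h2 : (2 : K) ≠ 0) {g : GL (Fin 2) K}
    (hg : g ∈ unitaryGroupOfForm σ (Matrix.of fun i j : Fin 2 => if i.val + j.val + 1 = 2 then (1 : K) else 0))
    (hΔ : g.val.trace ^ 2 ≠ 4 * g.val.det) :
    ∃ (A C ρ : K) (δ : GL (Fin 2) K), C ≠ 0 ∧ σ ρ = ρ ∧ ρ ≠ 0 ∧ δ.val = !![A, C * ρ; C, A] ∧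
      δ ∈ unitaryGroupOfForm σ (Matrix.of fun i j : Fin 2 => if i.val + j.val + 1 = 2 then (1 : K) else 0) ∧ δ.val.charpoly = g.val.charpoly := by
  obtain ⟨A, C, ρ, h2A, hC0, hσρ, hρ0, hdet, h1, h2'⟩ :=
    exists_corner_of_reciprocal σ hσσ hσ h2 (det_mul_map_det_eq_one_of_mem σ hg) (trace_eq_map_trace_mul_det_of_mem σ hg) hΔ
  obtain ⟨hdet', hχ⟩ := charpoly_corner A C ρ
  have hd0 : (!![A, C * ρ; C, A] : Matrix (Fin 2) (Fin 2) K).det ≠ 0 := by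
    rw [hdet', hdet]; exact ((Matrix.isUnit_iff_isUnit_det _).1 g.isUnit).ne_zero
  refine ⟨A, C, ρ, Matrix.GeneralLinearGroup.mkOfDetNeZero _ hd0, hC0, hσρ, hρ0, rfl,
    corner_mem_unitaryGroupOfForm σ hσρ h1 h2' _ rfl, ?_⟩
  change (!![A, C * ρ; C, A] : Matrix (Fin 2) (Fin 2) K).charpoly = _
  rw [hχ, Matrix.charpoly_fin_two, hdet, h2A]

/-- **Separable ⇒ `tr² ≠ 4·det`** for a `2 × 2` matrix over a field with `2 ≠ 0`: otherwise `χ = (X − tr∕2)²` is not square-free. [folklore; cite: Rogawski1990, §3.1 p. 19] -/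
theorem trace_sq_ne_four_mul_det_of_separable (h2 : (2 : K) ≠ 0) (M : Matrix (Fin 2) (Fin 2) K) (hsep : M.charpoly.Separable) :
    M.trace ^ 2 ≠ 4 * M.det := by
  intro hEq
  set a : K := M.trace / 2 with ha
  have h2a : 2 * a = M.trace := by rw [ha]; field_simp
  have h4 : (4 : K) ≠ 0 := by
    rw [show (4 : K) = 2 * 2 by norm_num]; exact mul_ne_zero h2 h2
  have hdet : M.det = a ^ 2 := by
    apply mul_left_cancel₀ h4
    rw [← hEq, ← h2a]; ring
  have hχ : M.charpoly = (X - Polynomial.C a) * (X - Polynomial.C a) := by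
    rw [Matrix.charpoly_fin_two, hdet, ← h2a, map_mul, map_pow, show Polynomial.C (2 : K) = 2 from map_ofNat _ 2]
    ring
  have hu := hsep.squarefree (X - Polynomial.C a) ⟨1, by rw [mul_one]; exact hχ⟩
  exact Polynomial.not_isUnit_X_sub_C _ hu

end Generic

/-! ## §4 Local currency: the type-(2) class is ONE class, represented by a corner literal -/

section Local

variable {F : Type} (E : Type) [Field F] [NumberField F] [Field E] [NumberField E] [Algebra F E] [Algebra.IsQuadraticExtension F E]
  (v : HeightOneSpectrum (𝓞 F)) (c : E ≃ₐ[F] E) {δ₀ : E} (hcδ : c δ₀ = -δ₀) (hδ₀ : δ₀ ≠ 0)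

include hcδ hδ₀ in
/-- **THE TYPE-(2) CELL IS ONE CORNER CLASS (local currency `E ⊗_F F_v`, `v` non-split).**  For `g ∈ U(Φ₂)(F_v) ⊂ GL₂(E_v)` (`Φ₂` the `antidiag(1,1)` literal) whose
characteristic polynomial is IRREDUCIBLE and separable over the field `E_v`, and `2 ≠ 0` in `E_v`: there are a corner literal `δ = (A, Cρ; C, A) ∈ U(Φ₂)(F_v)` (`C ≠ 0`,
`σρ = ρ ≠ 0`) and `h ∈ U(Φ₂)(F_v)` with `h g h⁻¹ = δ` — §3's corner has `χ_δ = χ_g`, so it is stably conjugate (★ `isStablyConj_iff_charpoly_eq_of_separable`), hence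
conjugate: the local class set of the ramified torus of `U(1,1)` is a singleton (★ `isConj_of_isStablyConj_of_irreducible_rankTwo`, Rog90 Lemma 3.6.1).
[cite: Rogawski1990, §3.6 p. 31, Lemma 3.6.1 p. 28; §3.5 Prop. 3.5.2 (a)(c) p. 29] [cite: Flicker1998UnitaryFL, Thm. 18 p. 97] -/
theorem exists_mem_conj_eq_corner_of_irreducible (w : PlacesOver E v) (hw : c • w.1 = w.1) (h2 : (2 : LocalRing E v) ≠ 0) {g : GL (Fin 2) (LocalRing E v)}
    (hg : g ∈ unitaryGroupOfForm (conjLocal E c v) (Matrix.of fun i j : Fin 2 => if i.val + j.val + 1 = 2 then (1 : LocalRing E v) else 0))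
    (hirr : Irreducible g.val.charpoly) (hsep : g.val.charpoly.Separable) :
    ∃ (A C ρ : LocalRing E v) (δ h : GL (Fin 2) (LocalRing E v)), C ≠ 0 ∧ conjLocal E c v ρ = ρ ∧ ρ ≠ 0 ∧ δ.val = !![A, C * ρ; C, A] ∧
      δ ∈ unitaryGroupOfForm (conjLocal E c v) (Matrix.of fun i j : Fin 2 => if i.val + j.val + 1 = 2 then (1 : LocalRing E v) else 0) ∧
      h ∈ unitaryGroupOfForm (conjLocal E c v) (Matrix.of fun i j : Fin 2 => if i.val + j.val + 1 = 2 then (1 : LocalRing E v) else 0) ∧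
      h * g * h⁻¹ = δ := by
  have hc1 : c ≠ 1 := by
    rintro rfl
    rw [AlgEquiv.one_apply] at hcδ
    have h2δ : (2 : E) * δ₀ = 0 := by linear_combination hcδ
    exact hδ₀ ((mul_eq_zero.1 h2δ).resolve_left two_ne_zero)
  letI : Field (LocalRing E v) := (LocalRing.isField_of_smul_eq c hc1 w hw).toField
  have h2' : (2 : LocalRing E v) ≠ 0 := h2
  have hσσ : ∀ x, conjLocal E c v (conjLocal E c v x) = x := Liu2021.LemD1OfPlace.conjLocal_conjLocal_apply E v c hcδ hδ₀
  -- `σ` is non-trivial on `E_v`: it negates `δ₀ ⊗ 1 ≠ 0`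
  have hσ : ∃ z, conjLocal E c v z ≠ z := by
    refine ⟨algebraMap E (LocalRing E v) δ₀, fun h => ?_⟩
    have hδv : algebraMap E (LocalRing E v) δ₀ ≠ 0 := (_root_.map_ne_zero _).2 hδ₀
    rw [conjLocal_algebraMap, hcδ, map_neg] at h
    have h3 : (2 : LocalRing E v) * algebraMap E (LocalRing E v) δ₀ = 0 := by linear_combination -h
    exact hδv ((mul_eq_zero.1 h3).resolve_left h2')
  -- separability read as `tr² ≠ 4 det`
  have hΔ : g.val.trace ^ 2 ≠ 4 * g.val.det := trace_sq_ne_four_mul_det_of_separable h2' g.val hsep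
  -- the corner with `χ_δ = χ_g`
  obtain ⟨A, C, ρ, δ, hC0, hσρ, hρ0, hδval, hδU, hχ⟩ := exists_corner_mem_charpoly_eq (conjLocal E c v) hσσ hσ h2' hg hΔ
  -- the two memberships in the `unitaryGroup` spelling of the ★ class theorems
  have hgU : g ∈ unitaryGroup (conjLocal E c v) (Matrix.of fun i j : Fin 2 => if i.val + j.val + 1 = 2 then (1 : LocalRing E v) else 0) := by
    rw [unitaryGroup_eq_unitaryGroupOfForm]; exact hg
  have hδU' : δ ∈ unitaryGroup (conjLocal E c v) (Matrix.of fun i j : Fin 2 => if i.val + j.val + 1 = 2 then (1 : LocalRing E v) else 0) := by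
    rw [unitaryGroup_eq_unitaryGroupOfForm]; exact hδU
  have hH : ((Matrix.of fun i j : Fin 2 => if i.val + j.val + 1 = 2 then (1 : LocalRing E v) else 0).map (conjLocal E c v))ᵀ =
      Matrix.of fun i j : Fin 2 => if i.val + j.val + 1 = 2 then (1 : LocalRing E v) else 0 := by
    ext i j
    fin_cases i <;> fin_cases j <;> simp
  have hHd : IsUnit (Matrix.of fun i j : Fin 2 => if i.val + j.val + 1 = 2 then (1 : LocalRing E v) else 0).det := by
    rw [Matrix.det_fin_two]
    simp
  -- same separable characteristic polynomial ⇒ stably conjugate ⇒ conjugate (one class)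
  have hst : IsStablyConj (conjLocal E c v) _ (⟨g, hgU⟩ : unitaryGroup (conjLocal E c v) _) ⟨δ, hδU'⟩ :=
    (isStablyConj_iff_charpoly_eq_of_separable E v c _ ⟨g, hgU⟩ ⟨δ, hδU'⟩ hsep).2 hχ
  have hconj : IsConj (⟨g, hgU⟩ : unitaryGroup (conjLocal E c v) _) ⟨δ, hδU'⟩ :=
    isConj_of_isStablyConj_of_irreducible_rankTwo E v c hcδ hδ₀ w hw hH hHd hgU hirr ⟨δ, hδU'⟩ hst
  obtain ⟨u, hu⟩ := isConj_iff.1 hconj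
  refine ⟨A, C, ρ, δ, u.val, hC0, hσρ, hρ0, hδval, hδU, ?_, congrArg Subtype.val hu⟩
  rw [← unitaryGroup_eq_unitaryGroupOfForm]; exact u.2

end Local


/-! ## §5 CM dress: the (E2) letter shape `(h γ_H h⁻¹).1 = (A, Cρ; C, A)` for every type-(2) regular `γ_H ∈ H_v` -/

section CM

variable (L : Type) [Field L] [NumberField L] [IsCMField L] (v : HeightOneSpectrum (𝓞 ↥(maximalRealSubfield L)))

/-- **CM DRESS OF THE TYPE-(2) CELL.**  At a finite place `v` of `L⁺` non-split in the CM field `L` (`c • w = w`) with `2 ≠ 0` in `L ⊗ L⁺_v`, let `γ_H = (g, u) ∈ H_v =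
U(Φ₂)(L⁺_v) × U(Φ₁)(L⁺_v)` with `χ_g` IRREDUCIBLE and separable over the field `L ⊗ L⁺_v = L_w`.  Then some `h ∈ U(Φ₂)(L⁺_v)` conjugates `γ_H.1` onto a CORNER LITERAL:
`(h g h⁻¹) = (A, Cρ; C, A)` with `C ≠ 0`, `σρ = ρ ≠ 0` — the `hδ` letter shape of the (E2) head (`R90/R90-C14-typ1/g3/S6_E1352_…v2.3` :491), up to the valuation normalisation
`|ρ| = |ϖ|` (★ `corner_rescale` + the odd discriminant class, file C3).  §4 at `E := L`, `c :=` complex conjugation, `δ₀ :=` ★ `cmQuadraticGenerator_spec`'s `α`, and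
`(Φ₂)_v = antidiag(1,1)` literally (★ `UnitaryGroup.adelicForm_map_adeleToLocal`). [cite: Rogawski1990, §3.6 p. 31, Lemma 3.6.1 p. 28; §4.9 p. 55]
[cite: Flicker1998UnitaryFL, Thm. 18 p. 97] -/
theorem exists_conj_fst_eq_corner_of_irreducible (w : PlacesOver L v) (hw : IsCMField.complexConj L • w.1 = w.1) (h2 : (2 : LocalRing L v) ≠ 0)
    (γH : (cmDatum L 2 (Matrix.of fun i j : Fin 2 => if i.val + j.val + 1 = 2 then (1 : L) else 0)).Local v ×
      (cmDatum L 1 (Matrix.of fun i j : Fin 1 => if i.val + j.val + 1 = 1 then (1 : L) else 0)).Local v)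
    (hirr : Irreducible (γH.1.val : Matrix (Fin 2) (Fin 2) (LocalRing L v)).charpoly)
    (hsep : (γH.1.val : Matrix (Fin 2) (Fin 2) (LocalRing L v)).charpoly.Separable) :
    ∃ (h : (cmDatum L 2 (Matrix.of fun i j : Fin 2 => if i.val + j.val + 1 = 2 then (1 : L) else 0)).Local v) (A C ρ : LocalRing L v),
      C ≠ 0 ∧ conjLocal L (IsCMField.complexConj L) v ρ = ρ ∧ ρ ≠ 0 ∧
        (((h * γH.1 * h⁻¹ : (cmDatum L 2 (Matrix.of fun i j : Fin 2 => if i.val + j.val + 1 = 2 then (1 : L) else 0)).Local v).val :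
          GL (Fin 2) (LocalRing L v)) : Matrix (Fin 2) (Fin 2) (LocalRing L v)) = !![A, C * ρ; C, A] := by
  haveI : Algebra.IsQuadraticExtension ↥(maximalRealSubfield L) L := IsCMField.isQuadraticExtension L
  -- `(Φ₂)_v` is the literal `antidiag(1,1)` over `L ⊗ L⁺_v`
  have hΦ : cmLocalForm L 2 v = Matrix.of fun i j : Fin 2 => if i.val + j.val + 1 = 2 then (1 : LocalRing L v) else 0 := by
    rw [cmLocalForm, UnitaryGroup.adelicForm_map_adeleToLocal]
    ext i j
    simp only [Matrix.map_apply, Matrix.of_apply]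
    split_ifs <;> simp
  have hg : (γH.1.val : GL (Fin 2) (LocalRing L v)) ∈
      unitaryGroupOfForm (conjLocal L (IsCMField.complexConj L) v) (Matrix.of fun i j : Fin 2 => if i.val + j.val + 1 = 2 then (1 : LocalRing L v) else 0) := by
    rw [← hΦ]; exact γH.1.2
  obtain ⟨α, hα0, hαc, -⟩ := cmQuadraticGenerator_spec L
  obtain ⟨A, C, ρ, δ, h, hC0, hσρ, hρ0, hδval, -, hhU, hconj⟩ :=
    exists_mem_conj_eq_corner_of_irreducible L v (IsCMField.complexConj L) hαc hα0 w hw h2 hg hirr hsep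
  rw [← hΦ] at hhU
  refine ⟨⟨h, hhU⟩, A, C, ρ, hC0, hσρ, hρ0, ?_⟩
  rw [← hδval, ← hconj]
  rfl

end CM

end Summit.HodgeConjecture.HodgeConjecture.R90.S6

end
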